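import Mathlib.LinearAlgebra.Matrix.Rank
import Mathlib.LinearAlgebra.FiniteDimensional.Lemmas
import Literature.MathematicalPhysics.QuantumFieldTheory.Balaban1983to89.Beta.Composition

/-!
# `BalabanUV.Beta.FP.WardPairRankObstruction` — road «FP» for binder row D1, ROUTE T: **THE OBSTRUCTION TO READING THE COLOUR-STRIPPED TABLES
# THROUGH THE UN-LIFTED TWO-SIDED WARD LETTERS** (the OWNER's located finding F-FP-18-2 (3), as a RANK COUNT) — the reason the (STEP) door LIFTS COLOUR
# (option (δ): road BF-x's `D1BFx/ColourLift`, `cgen`-doubled jets) or FIXES THE SLICE (option (α): R-FP-54); IT KILLS NO LANDED THEOREM.  Content: if the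
# first-order form table is ANTISYMMETRIC, the un-lifted pair `a1 ∧ a1t` forces `2·H₀W₁ ∈ range 𝔔₀ᵀ`, and a bordered-nondegenerate `H₀` has too many
# independent columns for that — on some live column the pair is JOINTLY UNSATISFIABLE (§1, generic over `Fintype` indices)

WHY (OWNER d1-p3 g18, journal l.41032 ∕ l.41041, F-FP-18-2 ∕ Q-FP-18-2 ∕ proposed R-FP-54).  The torus call of ROUTE T (p313662 → Delta p316503 → Rows
p318378 → (B) p320614 → leaf-02 p321180 ∕ p321955) carries p308565's TWO-SIDED first-order Ward letters `a1 : H₁W₀ + H₀W₁ = 𝔔₀ᵀY₁` and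
`a1t : H₁ᵀW₀ + H₀ᵀW₁ = 𝔔₀ᵀY′₁` (order 0 discharged with `Y₀ = Y′₀ = 0`, leaf-02 `PeriodisedWardOrderZero` p317178, BECAUSE `H₀ᵀ = H₀`).  If the level-`j`
first-order form table `H₁ = H₁^{(h)}` is ANTISYMMETRIC as a matrix (the dictionary's Q-FP-18-2 — `AveragingHessianKernelsRooted.hessFFAt_antisymm` and its
TABLES-SYM twin; NOT asserted in this file, it is a HYPOTHESIS `h1 : H₁ᵀ = −H₁` here), then `a1 + a1t` reads `2·H₀W₁ = 𝔔₀ᵀ(Y₁ + Y′₁)`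
(`wardPair_sum`): every column of `H₀W₁` must lie in the range of the composite averaging rows' transposes.  The OWNER: «false for any `h ≠ 0` as far as I
can see … a kernel-checked `¬` is a small exact computation at `d = 1`, `Lc = 2` if wanted».  THIS FILE replaces the numerics by a DIMENSION COUNT valid for
every index size: a bordered non-degeneracy `det (kkt H₀ C) ≠ 0` (at the torus: leaf-05's `torus_h1` with `C = [Q₁₀; τ₁]`) gives `rank H₀ ≥ |ν| − |μ|`
(`card_le_rank_add_card_of_det_kkt_ne_zero`: `ker H₀ ∩ ker C = 0`); the columns of `H₀` off any finite «dead» set span a space of dimension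
`≥ |ν| − |μ| − #Dead`; the range of `𝔔₀ᵀ` has dimension `≤ |κ|`; so under `|κ| + |μ| + #Dead < |ν|` SOME live column `H₀[·, b]` is NOT in `range 𝔔₀ᵀ`
(`exists_live_col_not_mem_range`) — and along any first jet `W₁` whose column at some parameter `e` is `c·δ_b` (`c ≠ 0`; at the torus: leaf-02's ultralocal
generator jet `W₁^{(δ_b)}` at the fine residual parameter `e = b⁺`, p314580) the pair `a1 ∧ a1t` has NO witnesses `Y₁ Y′₁` (`exists_live_not_wardPair`).
Also typed: the OWNER's (1)–(2) — the congruence word `XᵀH₀ + H₀X` is symmetric (`congruenceWord_transpose`), so the (T-β-1) form-block letter in congruence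
shape `k1 : XᵀH₀ + H₁ + H₀X = H′₁` with `H₁ H′₁` antisymmetric forces `XᵀH₀ + H₀X = 0 ∧ H₁ = H′₁` (`k1_congruence_forces`).

WHAT THIS FILE DOES NOT SAY: whether the record's `H₁^{(h)}` IS antisymmetric (an2's answer to Q-FP-18-2; an1 g64 (A) `symHessFFAt_antisymm` and an3 g95
§1 say so for the rooted table — it stays a HYPOTHESIS here); anything about the LIFTED reading (δ) (there the `cgen`-doubled odd jets of antisymmetric tables
are SYMMETRIC — `ColourLift.lift_rel₁_transpose` — and `a1t` is `a1`: no obstruction) or the coloured theory (symmetric form, free slice exchange — the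
OWNER's (4)); any estimate.  It is the kernel reason the door does NOT read the stripped tables through the NAIVE real un-lifted letters.  It is [folklore] finite-dimensional linear algebra over Mathlib's
`Matrix.rank` ∕ `finrank` API (`Matrix.range_mulVecLin`, `LinearMap.finrank_range_add_finrank_ker`, `Submodule.finrank_add_finrank_le_of_disjoint`,
`Submodule.finrank_add_le_finrank_add_finrank`, `finrank_span_finset_le_card`, `Matrix.rank_le_card_width ∕ _height`, `Matrix.mulVec_injective_iff_isUnit`)
and the Literature bordered matrix `Composition.kkt`; no `def`, no `def … : Prop`, nothing cited, 0 sorry.  §1 is GENERIC over `Fintype` indices; the torus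
instance (the call's `hH₀ hQ₁₀ hτ₁` VERBATIM, leaf-02's `W₁^{(h)}`, leaf-05's `torus_h1`, the cardinality count `|κ| = (d+1)P∕Lc^{d+1}`,
`|μ| = (d+1)P + (Lc^{d+1} − 1)P`, `#Dead ≤ (d+1)P`, `|ν| = (d+1)Lc^{d+1}P`) is a separate leaf.

HONEST DEPENDENCY (page 1, mandatory): continuum YM on T⁴ ⇐ BetaPertH ∧ nine spine estimates (0/9 proved); BetaPertH ⇐ (D1) ∧ (D4) ∧ CAP+tail;
G-an2-4 gates asym, D1 and NE2/3/4.  HONEST FRAMING (cell contract, verbatim): «discharging `BetaPertH` makes Bałaban's UV stability UNCONDITIONAL —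
a real constructive-QFT result; it is NOT the continuum limit and NOT the Clay problem.»  ABSOLUTE RULE (cell charter, verbatim): «No internally-minted
statement may enter as a cited fact. Every hypothesis is either kernel-proved in this package or a verbatim quotation of a PUBLISHED theorem with page
reference. The manuscript(s) under audit are NOT citable for their own disputed steps — they are the thing under adjudication; programme-internal
(2001/route/tribunal) claims are never citable.»  A located NEGATIVE bookkeeping result about OUR typed letters; nothing of Bałaban's asserted; 0 estimates;
0∕4 row-D1 binders; NOT (T-ID), NOT SDF, NOT D1, NOT BetaPertH, NOT continuum, NOT Clay.  «not in print; our bookkeeping».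
Road «FP», D1 formalisation swarm leaf-02 (b2b-balaban-beta-d1-formalise-leaf-02) gen 19, 2026-08-22 (OFFER O-d1leaf02g19-1, journal l.41179; OWNER GO for §1 + §2
and the title, W-FP-18-8 (c) l.41213).
No existing file touched.
-/

namespace Summit.QuantumFields.BalabanUV.Beta.FP.WardPairRankObstruction

open Matrix Module
open Literature.MathematicalPhysics.QuantumFieldTheory.Balaban1983to89.Beta.Composition (kkt)

variable {ν μ κ ρ : Type*} [Fintype ν] [Fintype μ] [Fintype κ] [Fintype ρ] [DecidableEq ν] [DecidableEq μ] [DecidableEq κ]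

/-! ## §1.1 The OWNER's algebra (1)–(3): the two-sided Ward pair with an antisymmetric first-order form table -/

omit [Fintype ρ] [DecidableEq ν] [DecidableEq μ] [DecidableEq κ] [Fintype μ] in
/-- [folklore] **F-FP-18-2 (3): `a1 + a1t` with `H₀ᵀ = H₀`, `H₁ᵀ = −H₁` reads `2·H₀W₁ = 𝔔₀ᵀ(Y₁ + Y′₁)`** (the letters in their `Y₀ = 0` shapes, as in
leaf-02's Rows p318378 ∕ p321180). -/
theorem wardPair_sum {H₀ H₁ : Matrix ν ν ℝ} {W₀ W₁ : Matrix ν ρ ℝ} {𝔔₀ : Matrix κ ν ℝ} {Y₁ Y'₁ : Matrix κ ρ ℝ}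
    (h0 : H₀ᵀ = H₀) (h1 : H₁ᵀ = -H₁)
    (a1 : H₁ * W₀ + H₀ * W₁ = 𝔔₀ᵀ * Y₁) (a1t : H₁ᵀ * W₀ + H₀ᵀ * W₁ = 𝔔₀ᵀ * Y'₁) :
    (2 : ℝ) • (H₀ * W₁) = 𝔔₀ᵀ * (Y₁ + Y'₁) := by
  rw [h1, h0, Matrix.neg_mul] at a1t
  rw [Matrix.mul_add, ← a1, ← a1t, two_smul]
  abel

omit [Fintype μ] [Fintype κ] [DecidableEq ν] [DecidableEq μ] [DecidableEq κ] in
/-- [folklore] **F-FP-18-2 (1): for symmetric `H₀` the congruence word `XᵀH₀ + H₀X` is symmetric.** -/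
theorem congruenceWord_transpose {H₀ : Matrix ν ν ℝ} (X : Matrix ν ν ℝ) (h0 : H₀ᵀ = H₀) :
    (Xᵀ * H₀ + H₀ * X)ᵀ = Xᵀ * H₀ + H₀ * X := by
  rw [Matrix.transpose_add, Matrix.transpose_mul, Matrix.transpose_mul, Matrix.transpose_transpose, h0, add_comm]

omit [Fintype μ] [Fintype κ] [DecidableEq ν] [DecidableEq μ] [DecidableEq κ] in
/-- [folklore] **F-FP-18-2 (2): the (T-β-1) form-block letter IN CONGRUENCE SHAPE `k1 : XᵀH₀ + H₁ + H₀X = H′₁` with `H₁ H′₁` ANTISYMMETRIC and `H₀`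
symmetric forces `XᵀH₀ + H₀X = 0` and `H₁ = H′₁`** (symmetric = antisymmetric ⇒ both zero; characteristic `≠ 2`). -/
theorem k1_congruence_forces {H₀ H₁ H'₁ X : Matrix ν ν ℝ} (h0 : H₀ᵀ = H₀) (h1 : H₁ᵀ = -H₁) (h1' : H'₁ᵀ = -H'₁)
    (k1 : Xᵀ * H₀ + H₁ + H₀ * X = H'₁) : Xᵀ * H₀ + H₀ * X = 0 ∧ H₁ = H'₁ := by
  have hS : Xᵀ * H₀ + H₀ * X = H'₁ - H₁ := by rw [← k1]; abel
  have hsym := congruenceWord_transpose X h0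
  have hanti : (H'₁ - H₁)ᵀ = -(H'₁ - H₁) := by rw [Matrix.transpose_sub, h1, h1']; abel
  have h2 : H'₁ - H₁ = -(H'₁ - H₁) := by rw [← hanti, ← hS, hsym]
  have h3 : (H'₁ - H₁) + (H'₁ - H₁) = 0 := by
    nth_rewrite 2 [h2]
    exact add_neg_cancel _
  have hzero : H'₁ - H₁ = 0 := by
    have h4 : (2 : ℝ) • (H'₁ - H₁) = 0 := by rw [two_smul]; exact h3
    exact (smul_eq_zero.mp h4).resolve_left two_ne_zero
  refine ⟨by rw [hS, hzero], ?_⟩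
  exact (sub_eq_zero.mp hzero).symm

/-! ## §1.2 The rank of a bordered-nondegenerate form -/

omit [Fintype κ] [Fintype ρ] [DecidableEq κ] in
/-- [folklore] **`det (kkt H₀ C) ≠ 0 ⇒ |ν| ≤ rank H₀ + |μ|`**: the bordered matrix `[[H₀, Cᵀ],[C, 0]]` is injective, so `ker H₀ ∩ ker C = 0`, so
`dim ker H₀ ≤ dim (ν → ℝ) − dim ker C = rank C ≤ |μ|`. -/
theorem card_le_rank_add_card_of_det_kkt_ne_zero {H₀ : Matrix ν ν ℝ} {C : Matrix μ ν ℝ} (hkkt : (kkt H₀ C).det ≠ 0) :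
    Fintype.card ν ≤ H₀.rank + Fintype.card μ := by
  have hinj : Function.Injective (kkt H₀ C).mulVec :=
    Matrix.mulVec_injective_iff_isUnit.2 ((Matrix.isUnit_iff_isUnit_det _).2 hkkt.isUnit)
  -- `ker H₀ ⊓ ker C = ⊥`
  have hdisj : Disjoint (LinearMap.ker H₀.mulVecLin) (LinearMap.ker C.mulVecLin) := by
    rw [Submodule.disjoint_def]
    intro v hv hv'
    rw [LinearMap.mem_ker, Matrix.mulVecLin_apply] at hv hv'
    have hz : (kkt H₀ C) *ᵥ Sum.elim v 0 = (kkt H₀ C) *ᵥ 0 := by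
      rw [Matrix.mulVec_zero, kkt, Matrix.fromBlocks_mulVec]
      have e1 : (Sum.elim v (0 : μ → ℝ)) ∘ Sum.inl = v := rfl
      have e2 : (Sum.elim v (0 : μ → ℝ)) ∘ Sum.inr = 0 := rfl
      rw [e1, e2, hv, hv', Matrix.mulVec_zero, Matrix.mulVec_zero, add_zero, add_zero]
      funext i
      cases i <;> rfl
    have hvz := hinj hz
    funext i
    exact congrFun hvz (Sum.inl i)
  have hsum := Submodule.finrank_add_finrank_le_of_disjoint hdisj
  have hH := LinearMap.finrank_range_add_finrank_ker H₀.mulVecLin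
  have hC := LinearMap.finrank_range_add_finrank_ker C.mulVecLin
  have hCr : C.rank ≤ Fintype.card μ := Matrix.rank_le_card_height C
  rw [Module.finrank_fintype_fun_eq_card] at hH hC hsum
  unfold Matrix.rank at hCr ⊢
  omega

/-! ## §1.3 Too many independent live columns for the range of `𝔔₀ᵀ` -/

omit [Fintype ρ] [DecidableEq κ] in
/-- [folklore] **A LIVE COLUMN OF `H₀` OUTSIDE `range 𝔔₀ᵀ`**: if `det (kkt H₀ C) ≠ 0` and `|κ| + |μ| + #Dead < |ν|`, then some column `H₀[·, b]`
with `b ∉ Dead` is not of the form `𝔔₀ᵀ·y` — for ANY `𝔔₀ : Matrix κ ν ℝ`. -/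
theorem exists_live_col_not_mem_range {H₀ : Matrix ν ν ℝ} {C : Matrix μ ν ℝ} (hkkt : (kkt H₀ C).det ≠ 0) (𝔔₀ : Matrix κ ν ℝ) (Dead : Finset ν)
    (hcard : Fintype.card κ + Fintype.card μ + Dead.card < Fintype.card ν) :
    ∃ b ∉ Dead, H₀.col b ∉ LinearMap.range (𝔔₀ᵀ).mulVecLin := by
  classical
  by_contra hall
  push Not at hall
  have hrk := card_le_rank_add_card_of_det_kkt_ne_zero hkkt
  -- live and dead column sets
  set SL : Finset (ν → ℝ) := (Finset.univ \ Dead).image H₀.col with hSL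
  set SD : Finset (ν → ℝ) := Dead.image H₀.col with hSD
  -- every column is live or dead
  have hcols : Set.range H₀.col ⊆ (↑SL ∪ ↑SD : Set (ν → ℝ)) := by
    rintro _ ⟨b, rfl⟩
    by_cases hb : b ∈ Dead
    · exact Or.inr (by rw [hSD, Finset.coe_image]; exact ⟨b, by simpa using hb, rfl⟩)
    · exact Or.inl (by rw [hSL, Finset.coe_image]; exact ⟨b, by simpa using hb, rfl⟩)
  have hrange : LinearMap.range H₀.mulVecLin ≤ Submodule.span ℝ (↑SL : Set (ν → ℝ)) ⊔ Submodule.span ℝ (↑SD : Set (ν → ℝ)) := by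
    rw [Matrix.range_mulVecLin, ← Submodule.span_union]
    exact Submodule.span_mono hcols
  -- the live span sits inside `range 𝔔₀ᵀ`
  have hlive : Submodule.span ℝ (↑SL : Set (ν → ℝ)) ≤ LinearMap.range (𝔔₀ᵀ).mulVecLin := by
    rw [Submodule.span_le]
    intro v hv
    rw [hSL, Finset.coe_image] at hv
    obtain ⟨b, hb, rfl⟩ := hv
    have hb' : b ∉ Dead := by simpa using hb
    exact hall b hb'
  -- dimension count
  have h1 : finrank ℝ (LinearMap.range H₀.mulVecLin)
      ≤ finrank ℝ (Submodule.span ℝ (↑SL : Set (ν → ℝ)) ⊔ Submodule.span ℝ (↑SD : Set (ν → ℝ)) : Submodule ℝ (ν → ℝ)) :=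
    Submodule.finrank_mono hrange
  have h2 := Submodule.finrank_add_le_finrank_add_finrank (Submodule.span ℝ (↑SL : Set (ν → ℝ))) (Submodule.span ℝ (↑SD : Set (ν → ℝ)))
  have h3 : finrank ℝ (Submodule.span ℝ (↑SL : Set (ν → ℝ))) ≤ Fintype.card κ :=
    (Submodule.finrank_mono hlive).trans (Matrix.rank_le_card_width (𝔔₀ᵀ))
  have h4 : finrank ℝ (Submodule.span ℝ (↑SD : Set (ν → ℝ))) ≤ Dead.card :=
    (finrank_span_finset_le_card SD).trans Finset.card_image_le
  unfold Matrix.rank at hrk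
  omega

/-! ## §1.4 The two-sided Ward pair has no witnesses along a live ultralocal first jet -/

omit [Fintype ρ] [DecidableEq κ] in
/-- [folklore] **F-FP-18-2 (3), KERNEL FORM (generic): under a bordered non-degeneracy `det (kkt H₀ C) ≠ 0`, `H₀ᵀ = H₀`, and the count
`|κ| + |μ| + #Dead < |ν|`, there is a live index `b ∉ Dead` such that for EVERY antisymmetric `H₁`, every `W₀`, and every first jet `W₁` having a column
`W₁[·, e] = c·δ_b` (`c ≠ 0`), the pair `a1 : H₁W₀ + H₀W₁ = 𝔔₀ᵀY₁`, `a1t : H₁ᵀW₀ + H₀ᵀW₁ = 𝔔₀ᵀY′₁` has NO witnesses `Y₁ Y′₁`.** -/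
theorem exists_live_not_wardPair {H₀ : Matrix ν ν ℝ} {C : Matrix μ ν ℝ} (h0 : H₀ᵀ = H₀) (hkkt : (kkt H₀ C).det ≠ 0) (𝔔₀ : Matrix κ ν ℝ)
    (Dead : Finset ν) (hcard : Fintype.card κ + Fintype.card μ + Dead.card < Fintype.card ν) :
    ∃ b ∉ Dead, ∀ (H₁ : Matrix ν ν ℝ) (W₀ W₁ : Matrix ν ρ ℝ) (e : ρ) (c : ℝ), H₁ᵀ = -H₁ → c ≠ 0 →
      (∀ a, W₁ a e = if a = b then c else 0) →
      ¬ ∃ Y₁ Y'₁ : Matrix κ ρ ℝ, H₁ * W₀ + H₀ * W₁ = 𝔔₀ᵀ * Y₁ ∧ H₁ᵀ * W₀ + H₀ᵀ * W₁ = 𝔔₀ᵀ * Y'₁ := by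
  obtain ⟨b, hb, hcol⟩ := exists_live_col_not_mem_range hkkt 𝔔₀ Dead hcard
  refine ⟨b, hb, fun H₁ W₀ W₁ e c h1 hc hW hex => hcol ?_⟩
  obtain ⟨Y₁, Y'₁, a1, a1t⟩ := hex
  have hsum := wardPair_sum h0 h1 a1 a1t
  -- read the identity at column `e`: `2·c·H₀[a, b] = Σ_k 𝔔₀ᵀ[a, k]·(Y₁ + Y′₁)[k, e]`
  have key : ∀ a, 2 * (H₀ a b * c) = ∑ k, 𝔔₀ᵀ a k * (Y₁ + Y'₁) k e := by
    intro a
    have h := congrFun (congrFun hsum a) e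
    simp only [Matrix.smul_apply, Matrix.mul_apply, smul_eq_mul, hW, mul_ite, mul_zero, Finset.sum_ite_eq', Finset.mem_univ,
      if_true] at h
    exact h
  refine LinearMap.mem_range.2 ⟨(2 * c)⁻¹ • (fun k => (Y₁ + Y'₁) k e), ?_⟩
  rw [map_smul, Matrix.mulVecLin_apply]
  funext a
  have hcb : H₀.col b a = H₀ a b := rfl
  simp only [Pi.smul_apply, smul_eq_mul, Matrix.mulVec, dotProduct, hcb]
  rw [← key a]
  field_simp

end Summit.QuantumFields.BalabanUV.Beta.FP.WardPairRankObstruction
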